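import Literature.Computability.Cryptography.CoinBlockLaws
import Literature.Probability.Distributions.RoundedGaussianProduct
import Literature.Probability.Distributions.PseudoGaussianSamplerParams
import Literature.Probability.Distributions.PseudoGaussianSamplerCoins
import HarnessLib

/-!
# The perturbation read off the coins: `n` flat pseudo-Gaussian samples form a product law close to the rounded Gaussian

Topic `Computability/Cryptography` (family `pqc`), assembly of `CoinBlockLaws.lean` (chunks of a uniform
string are independent uniform words; coordinatewise maps give product laws),
`Probability/Distributions/PseudoGaussianSamplerCoins.lean` (`PGParams.samplerFlat`: the sampler on a
flat coin string, `card_samplerFlat_eq`: `#{v ∈ {0,1}^{coinLen} | samplerFlat v = j} = ℓ'(j) 2^{coinLen}`),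
`PseudoGaussianSamplerTV.lean` / `PseudoGaussianSamplerParams.lean` (`PGParams.lawPMF`, the standard
parameters `PGParams.std m b` with `Δ(ℓ', ℓ_b) ≤ 8·2^{-m}`) and `RoundedGaussianProduct.lean`
(`roundedGaussian n (2ᵇ/√2) = ⨂ⁿ ℓ_b`). It is the law-level description of the perturbation `w ∈ ℤⁿ` that
the machine of the first component of Peikert's `GapSVP → LWE` reduction (`PeikertReduction.lean`,
pqc.S20) manufactures from a block of `n · coinLen` coins, coordinate by coordinate. All PROVED:

* `indepLaw_uniformOfFintype` — `⨂ⁿ U W = U (Fin n → W)`;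
* `uniformVector_map_samplerFlat_eq_lawPMF` — **the flat sampler on uniform coins has law `ℓ'`**
  (`PGParams.lawPMF`), the `PMF` form of `card_samplerFlat_eq`;
* `uniformPi_map_samplerFlat_eq_indepLaw`, **`uniformVector_map_samplerVec_eq_indepLaw`** — `n` samples
  read off `n` chunks of a uniform string of length `n · coinLen` are INDEPENDENT with law `ℓ'` each
  (`PGParams.samplerVec`);
* **`tvDist_samplerVec_roundedGaussian_le`** — at the standard parameters `std m b` (`1 ≤ m`,
  `m + rOf m + 1 ≤ b`) the vector of samples is within statistical distance `n · 8 · 2^{-m}` of the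
  rounded Gaussian `roundedGaussian n (2ᵇ/√2)` — so every event of the analysis written for the exact
  rounded Gaussian (`PeikertPerturbation*.lean`) changes probability by at most that much
  (`abs_toReal_toOuterMeasure_sub_le_tvDist`).

## References

* S. Arora, B. Barak, *Computational Complexity: A Modern Approach*, CUP 2009, Def. 7.1 (a probabilistic
  machine reads a uniform random string) [AroraBarak2009].
* O. Goldreich, *Foundations of Cryptography I*, CUP 2001, §3.2.3 (statistical distance of independent
  products) [Goldreich2001].
* C. Peikert, *Public-key cryptosystems from the worst-case shortest vector problem*, STOC 2009, proof of
  Thm. 3.1 (step 1: sample the perturbation) [Peikert2009].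
-/

noncomputable section

namespace Literature.Computability.Cryptography

open Finset PMF Literature.Probability.Distributions
open scoped ENNReal

/-! ### The independent product of uniform laws is uniform -/

/-- `⨂ⁿ U W = U (Fin n → W)`: `n` independent uniform words form a uniform family. [folklore] -/
theorem indepLaw_uniformOfFintype {W : Type*} [Fintype W] [Nonempty W] (n : ℕ) :
    (indepLaw n fun _ => uniformOfFintype W) = uniformOfFintype (Fin n → W) := by
  symm
  refine indepLaw_eq_of_apply _ _ fun y => ?_
  simp only [uniformOfFintype_apply, Fintype.card_pi, Finset.prod_const, card_univ, Fintype.card_fin]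
  push_cast
  rw [ENNReal.inv_pow]

/-! ### The law of the flat sampler under uniform coins -/

namespace PGParams

open Literature.Probability.Distributions.PGParams

variable (P : Literature.Probability.Distributions.PGParams)

/-- **The flat sampler on uniform coins has law `ℓ'`**: `(U {0,1}^{coinLen}).map samplerFlat = lawPMF`
(the `PMF` form of `card_samplerFlat_eq`). [folklore] -/
theorem uniformVector_map_samplerFlat_eq_lawPMF :
    (uniformOfFintype (List.Vector Bool P.coinLen)).map (fun v => P.samplerFlat v.toList) = P.lawPMF := by
  classical
  ext j
  rw [map_uniformOfFintype_apply, P.lawPMF_apply, card_vector, Fintype.card_bool]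
  have hcard := P.card_samplerFlat_eq j
  have hpow : ((2 ^ P.coinLen : ℕ) : ℝ≥0∞) = ENNReal.ofReal ((2 : ℝ) ^ P.coinLen) := by
    rw [ENNReal.ofReal_pow (by norm_num)]; simp
  have hnum : ((univ.filter fun v : List.Vector Bool P.coinLen => P.samplerFlat v.toList = j).card : ℝ≥0∞) =
      ENNReal.ofReal (P.law j * 2 ^ P.coinLen) := by
    rw [← hcard, ENNReal.ofReal_natCast]
  rw [hnum, hpow, ← ENNReal.ofReal_div_of_pos (by positivity), mul_div_assoc,
    div_self (by positivity), mul_one]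

/-- **`n` samplers on a uniform family of coin words are independent with law `ℓ'` each.** [folklore] -/
theorem uniformPi_map_samplerFlat_eq_indepLaw (n : ℕ) :
    (uniformOfFintype (Fin n → List.Vector Bool P.coinLen)).map (fun v i => P.samplerFlat (v i).toList) =
      indepLaw n fun _ => P.lawPMF := by
  classical
  rw [uniformPi_map_eq_indepLaw n (fun v : List.Vector Bool P.coinLen => P.samplerFlat v.toList),
    uniformVector_map_samplerFlat_eq_lawPMF]

/-- **The sampled vector read off a coin block**: coordinate `i` is the flat sampler applied to the `i`-th
chunk of width `coinLen` of the block (a string of length `≥ n · coinLen`). [cite: Peikert2009, Thm. 3.1 proof (step 1)] -/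
def samplerVec (n : ℕ) {C : ℕ} (hC : P.coinLen * n ≤ C) (blk : List.Vector Bool C) : Fin n → ℤ :=
  fun i => P.samplerFlat (chunks P.coinLen n hC blk i).toList

/-- **The sampled vector on a uniform block is `⨂ⁿ ℓ'`.** [folklore] -/
theorem uniformVector_map_samplerVec_eq_indepLaw (n : ℕ) {C : ℕ} (hC : P.coinLen * n ≤ C) :
    (uniformOfFintype (List.Vector Bool C)).map (samplerVec P n hC) = indepLaw n fun _ => P.lawPMF := by
  classical
  have hcomp : samplerVec P n hC =
      (fun v : Fin n → List.Vector Bool P.coinLen => fun i => P.samplerFlat (v i).toList) ∘ chunks P.coinLen n hC := rfl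
  rw [hcomp, ← PMF.map_comp, uniformVector_map_chunks_eq_indepLaw, indepLaw_uniformOfFintype,
    uniformPi_map_samplerFlat_eq_indepLaw]

end PGParams

/-! ### The sampled vector is close to the rounded Gaussian -/

/-- **The vector of `n` standard pseudo-Gaussian samples read off a uniform coin block is within statistical
distance `n · 8 · 2^{-m}` of `roundedGaussian n (2ᵇ/√2)`** (`1 ≤ m`, `m + rOf m + 1 ≤ b`; the block has
length `≥ n · coinLen`). [folklore] -/
theorem tvDist_samplerVec_roundedGaussian_le (n m b : ℕ) (hm : 1 ≤ m) (hb : m + PGParams.rOf m + 1 ≤ b) {C : ℕ}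
    (hC : (PGParams.std m b).coinLen * n ≤ C) :
    ((uniformOfFintype (List.Vector Bool C)).map (PGParams.samplerVec (PGParams.std m b) n hC)).tvDist
        (roundedGaussian n ((2 : ℝ) ^ b / Real.sqrt 2)) ≤ n * (8 * ((2 : ℝ) ^ m)⁻¹) := by
  rw [PGParams.uniformVector_map_samplerVec_eq_indepLaw]
  refine (tvDist_indepLaw_lawPMF_roundedGaussian_le n (PGParams.std m b) (PGParams.one_le_k_std m b)
    (PGParams.pNone_pow_J_std_lt_one m b)).trans ?_
  have h := PGParams.errorBound_std_le m b hm hb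
  have hb' : (PGParams.std m b).b = b := rfl
  rw [hb'] at *
  exact mul_le_mul_of_nonneg_left h (Nat.cast_nonneg n)

end Literature.Computability.Cryptography

end
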